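import Mathlib
import Summits.Ventures.PercRepro2.Defs
import Summits.Ventures.PercRepro2.Independence
import Summits.Ventures.PercRepro2.Harris
import Summits.Ventures.PercRepro2.ZCTwoEdge
import Summits.Ventures.PercRepro2.ZCLeafReductions

/-!
# The root-leaf reduction of (ZC): a pendant root `a₁` reduces (ZC) to `G − a₁`
(blind cell PercRepro2, mine-a g23; MINE-A.md §70.5, (L₁))

Let the root `a₁` be a leaf, joined to the rest only by `f = za₁` of weight `w`, and assume
`{a₁} ∉ 𝒰`.  In `G⁻ = G − a₁` (the configuration `ω⁻ = ω[f ↦ closed]`) take the marks `(z, a₃, o)`: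
`e_z = {z ↔ a₃}`, `L_z = {z ↔ o}`, `γ' = {a₃ ↔ o}`, the five types `T₁ = e_zL_z`, `T₂ = e_z¬L_z`,
`T₃ = ¬e_zL_z`, `B_z`, `D_z` (with `γ' = T₁ ∪ B_z`), and the up-set event `X' = {C⁻(z) ∈ 𝒰'}`,
`𝒰' = {S ∣ S ∪ {a₁} ∈ 𝒰}`.  Then `e = {f open} ∩ e_z`, `L = {f open} ∩ L_z`, `γ = γ'`,
`U = {f open} ∩ X'`, and one-edge pinning gives the exact identity
  `(ZC)_G = w · Z⁻ + w(1−w) · (W1) + w(1−w)² · P(X') P(T₁) P(T₃)`,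
where `Z⁻ = P(D_z) Cov(X', T₁) − P(B_z) Cov(X', T₂)` is the (ZC) expression of `G⁻` and
  `(W1) = (P(T₂) + P(T₃)) Cov(X', T₁) − P(T₁) Cov(X', T₂) + P(X') (P(D_z)P(T₁) − P(B_z)P(T₂))`.
The new ingredient is `(W1) ≥ 0` (`w1_nonneg`), which follows from `Z⁻ ≥ 0`, two Harris
inequalities (`X'` vs `T₁`; `X'` vs the decreasing `T₂ ∪ D_z`) and lemma (P1) on `G⁻` through two
polynomial certificates (one per regime `P(B_z)P(T₃) ≷ (P1)`):
  `P(B_z)·(W1) = P(T₁)·Z⁻ + Cov(X',T₁)·(P(B_z)P(T₃) − (P1)) + P(B_z)P(X')(P1)`,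
  `P(D_z)(P(T₁)+P(B_z))·(W1) = (P(T₂)(P(T₁)+P(B_z)) + P(T₁)P(T₃))·Z⁻ + ((P(T₁)+P(B_z))(P1) − P(B_z)P(T₁)P(T₃))·(P(X')P(T₂ ∪ D_z) − P(X' ∩ T₂)) + P(D_z)P(B_z)P(T₃)·P(X' ∩ T₁)`.
Hence `(ZC)_G ≥ w · Z⁻` whenever `Z⁻ ≥ 0` (`zc_leaf_root`).  With (L0), (L_o), (L₃) of
`ZCLeafReductions` the (ZC) class is closed under attaching ANY leaf — in particular (ZC) holds on
every finite tree (MINE-A.md §70.5).  One seat; identities twinned in exact rationals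
(data/mine-a/g23/codes/twin_leaf_a1.py, 500 cells, 0 failures of `(ZC)_G ≥ w Z⁻`).
-/

namespace Summit.Ventures.PercRepro2

section W1

variable {R : Type*} [CommRing R] [LinearOrder R] [IsStrictOrderedRing R]

/-- **(W1) ≥ 0** from `Z⁻ ≥ 0`, Harris, Harris-mixed and (P1), by the two certificates. -/
lemma w1_nonneg (T₁ T₂ T₃ B D x₁ x₂ x₃ xB xD : R) (hT1 : 0 ≤ T₁) (hT2 : 0 ≤ T₂) (hT3 : 0 ≤ T₃)
    (hB : 0 ≤ B) (hD : 0 ≤ D) (hx1 : 0 ≤ x₁) (hx2 : 0 ≤ x₂) (hx3 : 0 ≤ x₃) (hxB : 0 ≤ xB)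
    (hxD : 0 ≤ xD) (hP1 : 0 ≤ D * T₁ - B * T₂)
    (hZ : 0 ≤ D * (x₁ - (x₁ + x₂ + x₃ + xB + xD) * T₁)
      - B * (x₂ - (x₁ + x₂ + x₃ + xB + xD) * T₂))
    (hc1 : (x₁ + x₂ + x₃ + xB + xD) * T₁ ≤ x₁)
    (hmix : x₂ + xD ≤ (x₁ + x₂ + x₃ + xB + xD) * (T₂ + D)) :
    0 ≤ (T₂ + T₃) * (x₁ - (x₁ + x₂ + x₃ + xB + xD) * T₁)
      - T₁ * (x₂ - (x₁ + x₂ + x₃ + xB + xD) * T₂)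
      + (x₁ + x₂ + x₃ + xB + xD) * (D * T₁ - B * T₂) := by
  set M := x₁ + x₂ + x₃ + xB + xD with hM
  have hM0 : 0 ≤ M := by positivity
  set W := (T₂ + T₃) * (x₁ - M * T₁) - T₁ * (x₂ - M * T₂) + M * (D * T₁ - B * T₂) with hW
  set Z := D * (x₁ - M * T₁) - B * (x₂ - M * T₂) with hZdef
  have hc1' : 0 ≤ x₁ - M * T₁ := sub_nonneg.2 hc1
  have hH : 0 ≤ M * (T₂ + D) - x₂ := by linarith
  by_cases h : B * T₃ ≤ D * T₁ - B * T₂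
  · -- regime `(P1) ≥ B T₃`: the second certificate
    have key : D * (T₁ + B) * W = (T₂ * (T₁ + B) + T₁ * T₃) * Z
        + ((T₁ + B) * (D * T₁ - B * T₂) - B * T₁ * T₃) * (M * (T₂ + D) - x₂)
        + D * B * T₃ * x₁ := by
      simp only [hW, hZdef, hM]; ring
    have hμ : 0 ≤ (T₁ + B) * (D * T₁ - B * T₂) - B * T₁ * T₃ := by
      have h1 : (T₁ + B) * (B * T₃) = B * T₁ * T₃ + B * B * T₃ := by ring
      have h2 := mul_nonneg (mul_nonneg hB hB) hT3
      have h3 : (T₁ + B) * (B * T₃) ≤ (T₁ + B) * (D * T₁ - B * T₂) :=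
        mul_le_mul_of_nonneg_left h (by linarith)
      linarith
    have hrhs : 0 ≤ D * (T₁ + B) * W := by
      rw [key]
      exact add_nonneg (add_nonneg (mul_nonneg (by positivity) hZ) (mul_nonneg hμ hH))
        (mul_nonneg (by positivity) hx1)
    rcases (mul_nonneg hD (add_nonneg hT1 hB)).lt_or_eq with hpos | hzero
    · exact nonneg_of_mul_nonneg_right (by linarith [hrhs]) hpos
    · -- degenerate: `D (T₁ + B) = 0`
      rcases mul_eq_zero.1 hzero.symm with hD0 | hTB
      · -- `D = 0`: then `B T₂ = 0`, `B T₃ = 0`, and Harris-mixed gives `x₂ ≤ M T₂`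
        have hBT2 : B * T₂ = 0 := by
          have := mul_nonneg hB hT2; rw [hD0] at hP1; linarith
        have hBT3 : B * T₃ = 0 := by
          have := mul_nonneg hB hT3; rw [hD0] at h; linarith
        have hx2' : x₂ ≤ M * T₂ := by rw [hD0] at hmix; linarith
        have : 0 ≤ (T₂ + T₃) * (x₁ - M * T₁) := mul_nonneg (add_nonneg hT2 hT3) hc1'
        have : 0 ≤ T₁ * (M * T₂ - x₂) := mul_nonneg hT1 (by linarith)
        simp only [hW]; rw [hD0]; nlinarith
      · -- `T₁ + B = 0`: `T₁ = B = 0`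
        have hT10 : T₁ = 0 := by linarith
        have hB0 : B = 0 := by linarith
        simp only [hW]; rw [hT10, hB0]
        have : 0 ≤ (T₂ + T₃) * x₁ := mul_nonneg (add_nonneg hT2 hT3) hx1
        nlinarith
  · -- regime `(P1) < B T₃` (so `B > 0`): the first certificate
    rw [not_le] at h
    have key : B * W = T₁ * Z + (x₁ - M * T₁) * (B * T₃ - (D * T₁ - B * T₂))
        + B * M * (D * T₁ - B * T₂) := by
      simp only [hW, hZdef, hM]; ring
    have hBpos : 0 < B := by
      rcases hB.lt_or_eq with hB' | hB'
      · exact hB'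
      · exfalso; rw [← hB'] at h; simp at h; have := mul_nonneg hD hT1; linarith
    have hrhs : 0 ≤ B * W := by
      rw [key]
      exact add_nonneg (add_nonneg (mul_nonneg hT1 hZ) (mul_nonneg hc1' (by linarith)))
        (mul_nonneg (mul_nonneg hB hM0) hP1)
    exact nonneg_of_mul_nonneg_right (by linarith [hrhs]) hBpos

end W1

section LeafRootAbstract

variable {E : Type*} [Fintype E] [DecidableEq E] {R : Type*} [CommRing R] [LinearOrder R]
  [IsStrictOrderedRing R]

/-- **(L₁), abstract form.**  `f` is the leaf edge at the root; `e_z`, `L_z`, `γ'`, `X'` ignore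
`f`; `e_z`, `L_z`, `γ'`, `X'` increasing; `γ' = (e_z ∩ L_z) ∪ (e_zᶜ ∩ L_zᶜ ∩ γ')`; (P1) on `G⁻`;
and `Z⁻ ≥ 0` (the (ZC) expression of `G⁻` for `(z, a₃, o)` and `X'`).  Then the (ZC) expression of
`G` (with `e = {f open} ∩ e_z`, `L = {f open} ∩ L_z`, `U = {f open} ∩ X'`, `γ = γ'`) is at least
`p f · Z⁻`. -/
theorem zc_leaf_root {p : E → R} (hp : IsProbVec p) (f : E) {ez Lz γ' X' : Set (Config E)}
    (hez : ∀ (ω : Config E) (b : Bool), Function.update ω f b ∈ ez ↔ ω ∈ ez)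
    (hLz : ∀ (ω : Config E) (b : Bool), Function.update ω f b ∈ Lz ↔ ω ∈ Lz)
    (hγ' : ∀ (ω : Config E) (b : Bool), Function.update ω f b ∈ γ' ↔ ω ∈ γ')
    (hX' : ∀ (ω : Config E) (b : Bool), Function.update ω f b ∈ X' ↔ ω ∈ X')
    (hezup : IsUpperSet ez) (hLzup : IsUpperSet Lz) (hγ'up : IsUpperSet γ') (hX'up : IsUpperSet X')
    (hγeq : γ' = (ez ∩ Lz) ∪ (ezᶜ ∩ Lzᶜ ∩ γ'))
    (hP1 : prob p (ezᶜ ∩ Lzᶜ ∩ γ') * prob p (ez ∩ Lzᶜ)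
      ≤ prob p (ezᶜ ∩ Lzᶜ ∩ γ'ᶜ) * prob p (ez ∩ Lz))
    (hZ : 0 ≤ prob p (ezᶜ ∩ Lzᶜ ∩ γ'ᶜ) * (prob p (X' ∩ (ez ∩ Lz)) - prob p X' * prob p (ez ∩ Lz))
      - prob p (ezᶜ ∩ Lzᶜ ∩ γ') * (prob p (X' ∩ (ez ∩ Lzᶜ)) - prob p X' * prob p (ez ∩ Lzᶜ))) :
    let e := openEdge f ∩ ez
    let L := openEdge f ∩ Lz
    let U := openEdge f ∩ X'
    let γ := γ'
    prob p (eᶜ ∩ Lᶜ ∩ γᶜ) * (prob p (U ∩ (e ∩ L)) - prob p U * prob p (e ∩ L))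
      - prob p (eᶜ ∩ Lᶜ ∩ γ) * (prob p (U ∩ (e ∩ Lᶜ)) - prob p U * prob p (e ∩ Lᶜ))
      ≥ p f * (prob p (ezᶜ ∩ Lzᶜ ∩ γ'ᶜ) * (prob p (X' ∩ (ez ∩ Lz)) - prob p X' * prob p (ez ∩ Lz))
          - prob p (ezᶜ ∩ Lzᶜ ∩ γ') * (prob p (X' ∩ (ez ∩ Lzᶜ)) - prob p X' * prob p (ez ∩ Lzᶜ))) := by
  intro e L U γ
  set w := p f with hw
  set T₁ := prob p (ez ∩ Lz) with hT₁
  set T₂ := prob p (ez ∩ Lzᶜ) with hT₂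
  set T₃ := prob p (ezᶜ ∩ Lz) with hT₃
  set Bz := prob p (ezᶜ ∩ Lzᶜ ∩ γ') with hBz
  set Dz := prob p (ezᶜ ∩ Lzᶜ ∩ γ'ᶜ) with hDz
  set x₁ := prob p (X' ∩ (ez ∩ Lz)) with hx₁
  set x₂ := prob p (X' ∩ (ez ∩ Lzᶜ)) with hx₂
  set x₃ := prob p (X' ∩ (ezᶜ ∩ Lz)) with hx₃
  set xB := prob p (X' ∩ (ezᶜ ∩ Lzᶜ ∩ γ')) with hxB
  set xD := prob p (X' ∩ (ezᶜ ∩ Lzᶜ ∩ γ'ᶜ)) with hxD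
  set X := prob p X' with hX
  -- the mass of `X'` splits over the five types
  have hXsum : X = x₁ + x₂ + x₃ + xB + xD := by
    have h1 := prob_inter_add_prob_inter_compl p X' ez
    have h2 := prob_inter_add_prob_inter_compl p (X' ∩ ez) Lz
    have h3 := prob_inter_add_prob_inter_compl p (X' ∩ ezᶜ) Lz
    have h4 := prob_inter_add_prob_inter_compl p (X' ∩ (ezᶜ ∩ Lzᶜ)) γ'
    rw [Set.inter_assoc X' ez Lz, Set.inter_assoc X' ez Lzᶜ] at h2
    rw [Set.inter_assoc X' ezᶜ Lz, Set.inter_assoc X' ezᶜ Lzᶜ] at h3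
    rw [Set.inter_assoc X' (ezᶜ ∩ Lzᶜ) γ', Set.inter_assoc X' (ezᶜ ∩ Lzᶜ) γ'ᶜ] at h4
    linarith
  -- `γ' = T₁ ∪ B_z` and `γ'ᶜ = T₂ ∪ T₃ ∪ D_z` in probability
  have hγp : prob p γ' = T₁ + Bz := by
    rw [hγeq, prob_union_of_disjoint]
    exact Set.disjoint_left.2 fun ω h1 h2 => h2.1.1 h1.1
  have hγc : prob p γ'ᶜ = T₂ + T₃ + Dz := by
    rw [prob_compl, hγp]
    have h1 := prob_inter_add_prob_inter_compl p Set.univ ez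
    have h2 := prob_inter_add_prob_inter_compl p ez Lz
    have h3 := prob_inter_add_prob_inter_compl p ezᶜ Lz
    have h4 := prob_inter_add_prob_inter_compl p (ezᶜ ∩ Lzᶜ) γ'
    simp only [Set.univ_inter, prob_univ] at h1
    linarith
  -- the pinned probabilities
  have PeL : prob p (e ∩ L) = w * T₁ := by
    rw [prob_pin_shift p f]
    have c1 : {ω | Function.update ω f true ∈ (e ∩ L)} = ez ∩ Lz := by
      ext ω; simp [e, L, hez, hLz]
    have c0 : {ω | Function.update ω f false ∈ (e ∩ L)} = ∅ := by
      ext ω; simp [e, L]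
    rw [c1, c0, prob_empty]; ring
  have PUeL : prob p (U ∩ (e ∩ L)) = w * x₁ := by
    rw [prob_pin_shift p f]
    have c1 : {ω | Function.update ω f true ∈ (U ∩ (e ∩ L))} = X' ∩ (ez ∩ Lz) := by
      ext ω; simp [e, L, U, hez, hLz, hX']; tauto
    have c0 : {ω | Function.update ω f false ∈ (U ∩ (e ∩ L))} = ∅ := by
      ext ω; simp [e, L, U]
    rw [c1, c0, prob_empty]; ring
  have PenL : prob p (e ∩ Lᶜ) = w * T₂ := by
    rw [prob_pin_shift p f]
    have c1 : {ω | Function.update ω f true ∈ (e ∩ Lᶜ)} = ez ∩ Lzᶜ := by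
      ext ω; simp [e, L, hez, hLz]
    have c0 : {ω | Function.update ω f false ∈ (e ∩ Lᶜ)} = ∅ := by
      ext ω; simp [e, L]
    rw [c1, c0, prob_empty]; ring
  have PUenL : prob p (U ∩ (e ∩ Lᶜ)) = w * x₂ := by
    rw [prob_pin_shift p f]
    have c1 : {ω | Function.update ω f true ∈ (U ∩ (e ∩ Lᶜ))} = X' ∩ (ez ∩ Lzᶜ) := by
      ext ω; simp [e, L, U, hez, hLz, hX']; tauto
    have c0 : {ω | Function.update ω f false ∈ (U ∩ (e ∩ Lᶜ))} = ∅ := by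
      ext ω; simp [e, L, U]
    rw [c1, c0, prob_empty]; ring
  have PU : prob p U = w * X := by
    rw [prob_pin_shift p f]
    have c1 : {ω | Function.update ω f true ∈ U} = X' := by
      ext ω; simp [U, hX']
    have c0 : {ω | Function.update ω f false ∈ U} = ∅ := by
      ext ω; simp [U]
    rw [c1, c0, prob_empty]; ring
  have PB : prob p (eᶜ ∩ Lᶜ ∩ γ) = w * Bz + (1 - w) * (T₁ + Bz) := by
    rw [prob_pin_shift p f]
    have c1 : {ω | Function.update ω f true ∈ (eᶜ ∩ Lᶜ ∩ γ)} = ezᶜ ∩ Lzᶜ ∩ γ' := by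
      ext ω; simp [e, L, γ, hez, hLz, hγ']
    have c0 : {ω | Function.update ω f false ∈ (eᶜ ∩ Lᶜ ∩ γ)} = γ' := by
      ext ω; simp [e, L, γ, hγ']
    rw [c1, c0, hγp]
  have PD : prob p (eᶜ ∩ Lᶜ ∩ γᶜ) = w * Dz + (1 - w) * (T₂ + T₃ + Dz) := by
    rw [prob_pin_shift p f]
    have c1 : {ω | Function.update ω f true ∈ (eᶜ ∩ Lᶜ ∩ γᶜ)} = ezᶜ ∩ Lzᶜ ∩ γ'ᶜ := by
      ext ω; simp [e, L, γ, hez, hLz, hγ']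
    have c0 : {ω | Function.update ω f false ∈ (eᶜ ∩ Lᶜ ∩ γᶜ)} = γ'ᶜ := by
      ext ω; simp [e, L, γ, hγ']
    rw [c1, c0, hγc]
  -- the inputs of `w1_nonneg`
  have hc1 : X * T₁ ≤ x₁ := prob_mul_prob_le_prob_inter hp hX'up (hezup.inter hLzup)
  have hmix : x₂ + xD ≤ X * (T₂ + Dz) := by
    have hlow : IsLowerSet (Lzᶜ ∩ γ'ᶜ) := hLzup.compl.inter hγ'up.compl
    have h := prob_inter_le_prob_mul_prob_of_isLowerSet hp hlow hX'up
    have e1 : (Lzᶜ ∩ γ'ᶜ) ∩ X' = (X' ∩ (ez ∩ Lzᶜ)) ∪ (X' ∩ (ezᶜ ∩ Lzᶜ ∩ γ'ᶜ)) := by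
      ext ω
      simp only [Set.mem_inter_iff, Set.mem_compl_iff, Set.mem_union]
      constructor
      · rintro ⟨⟨hL, hγ⟩, hx⟩
        by_cases he : ω ∈ ez
        · exact Or.inl ⟨hx, he, hL⟩
        · exact Or.inr ⟨hx, ⟨he, hL⟩, hγ⟩
      · rintro (⟨hx, he, hL⟩ | ⟨hx, ⟨he, hL⟩, hγ⟩)
        · refine ⟨⟨hL, fun hγ => ?_⟩, hx⟩
          rw [hγeq] at hγ
          rcases hγ with ⟨_, hL'⟩ | ⟨⟨he', _⟩, _⟩
          · exact hL hL'
          · exact he' he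
        · exact ⟨⟨hL, hγ⟩, hx⟩
    have e2 : Lzᶜ ∩ γ'ᶜ = (ez ∩ Lzᶜ) ∪ (ezᶜ ∩ Lzᶜ ∩ γ'ᶜ) := by
      ext ω
      simp only [Set.mem_inter_iff, Set.mem_compl_iff, Set.mem_union]
      constructor
      · rintro ⟨hL, hγ⟩
        by_cases he : ω ∈ ez
        · exact Or.inl ⟨he, hL⟩
        · exact Or.inr ⟨⟨he, hL⟩, hγ⟩
      · rintro (⟨he, hL⟩ | ⟨⟨he, hL⟩, hγ⟩)
        · refine ⟨hL, fun hγ => ?_⟩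
          rw [hγeq] at hγ
          rcases hγ with ⟨_, hL'⟩ | ⟨⟨he', _⟩, _⟩
          · exact hL hL'
          · exact he' he
        · exact ⟨hL, hγ⟩
    rw [e1, e2, prob_union_of_disjoint, prob_union_of_disjoint] at h
    · rw [mul_comm] at h; exact h
    · exact Set.disjoint_left.2 fun ω h1 h2 => h2.1.1 h1.1
    · exact Set.disjoint_left.2 fun ω h1 h2 => h2.2.1.1 h1.2.1
  have hZ' : 0 ≤ Dz * (x₁ - X * T₁) - Bz * (x₂ - X * T₂) := hZ
  have hP1' : 0 ≤ Dz * T₁ - Bz * T₂ := by linarith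
  have hW := w1_nonneg T₁ T₂ T₃ Bz Dz x₁ x₂ x₃ xB xD (prob_nonneg hp _) (prob_nonneg hp _)
    (prob_nonneg hp _) (prob_nonneg hp _) (prob_nonneg hp _) (prob_nonneg hp _)
    (prob_nonneg hp _) (prob_nonneg hp _) (prob_nonneg hp _) (prob_nonneg hp _) hP1'
    (by rw [← hXsum]; exact hZ') (by rw [← hXsum]; exact hc1) (by rw [← hXsum]; exact hmix)
  rw [← hXsum] at hW
  -- the master identity
  have hw0 := hp.nonneg f
  have hw1 := hp.le_one f
  have hT1 : 0 ≤ T₁ := prob_nonneg hp _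
  have hT3 : 0 ≤ T₃ := prob_nonneg hp _
  have hX0 : 0 ≤ X := prob_nonneg hp _
  have key : (w * Dz + (1 - w) * (T₂ + T₃ + Dz)) * (w * x₁ - w * X * (w * T₁))
      - (w * Bz + (1 - w) * (T₁ + Bz)) * (w * x₂ - w * X * (w * T₂))
      - w * (Dz * (x₁ - X * T₁) - Bz * (x₂ - X * T₂))
      = w * (1 - w) * ((T₂ + T₃) * (x₁ - X * T₁) - T₁ * (x₂ - X * T₂) + X * (Dz * T₁ - Bz * T₂))
        + w * (1 - w) ^ 2 * X * T₁ * T₃ := by ring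
  have hnn : 0 ≤ w * (1 - w) * ((T₂ + T₃) * (x₁ - X * T₁) - T₁ * (x₂ - X * T₂)
      + X * (Dz * T₁ - Bz * T₂)) + w * (1 - w) ^ 2 * X * T₁ * T₃ :=
    add_nonneg (mul_nonneg (mul_nonneg hw0 (sub_nonneg.2 hw1)) hW)
      (mul_nonneg (mul_nonneg (mul_nonneg (mul_nonneg hw0 (sq_nonneg _)) hX0) hT1) hT3)
  rw [PeL, PUeL, PenL, PUenL, PU, PB, PD]
  linarith [key, hnn]

end LeafRootAbstract

end Summit.Ventures.PercRepro2
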